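import Summits.ResolutionOfSingularities.ResolutionOfSingularities.Theorems.FrobeniusLadderFRationalResolutionSegreMemIff
import Literature.AlgebraicGeometry.Resolution.AffineDomainDimension
import Mathlib.Algebra.MonoidAlgebra.MapDomain
import Mathlib.RingTheory.AlgebraicIndependent.TranscendenceBasis
import HarnessLib

/-!
# Cone programme, Segre family: `dim k[xᵢyⱼ] ≥ a + b − 1` (the Segre cone has dimension exactly `a + b − 1`)

Support file for crux stmt-ResolutionOfSingularities-15317 (`FrobeniusLadder.FRationalResolution`), line `redirect`,
CONE PROGRAMME. The sibling file `…SegreVertexSingular.lean` bounds the Krull dimension of the Segre ring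
`SR[a,b] = k[xᵢyⱼ] ⊆ k[x₁,…,x_a,y₁,…,y_b]` from ABOVE by `a + b − 1` (dehomogenisation); here the bound from BELOW:

* `segre_exists_injective_algHom_mvPolynomial` — the `k`-algebra map `k[T_v : v ≠ inl i₀] → SR[a,b]`,
  `T_{inl i} ↦ xᵢy_{j₀}` (`i ≠ i₀`), `T_{inr j} ↦ x_{i₀}yⱼ`, is INJECTIVE: it is the monomial map along the additive exponent
  map `θ` (`ε_{inl i} ↦ ε_{inl i} + ε_{inr j₀}`, `ε_{inr j} ↦ ε_{inl i₀} + ε_{inr j}`), which has an explicit additive retraction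
  (so the `a + b − 1` monomials `xᵢy_{j₀}` (`i ≠ i₀`), `x_{i₀}yⱼ` are algebraically independent);
* `segre_le_ringKrullDim` — hence `a + b − 1 ≤ trdeg_k SR[a,b] = dim SR[a,b]` (`trdeg_le_of_injective`,
  `MvPolynomial.trdeg_of_isDomain`, and `dim = trdeg` for affine domains,
  `Literature.…exists_ringKrullDim_eq_and_trdeg_eq`, Matsumura Thm. 5.6).
[folklore; cf. BrunsHerzog1998 §6.1; Matsumura1987, Thm. 5.6] Only Mathlib and the landed tree files above are used; no named
published fact.
-/

-- single-problem summit: the doubled namespace component is forced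
set_option linter.dupNamespace false

noncomputable section

namespace Summit.ResolutionOfSingularities.ResolutionOfSingularities.Theorems.FRationalResolution

open MvPolynomial
open Literature.AlgebraicGeometry.Resolution

section Cones

variable (k : Type) [Field k]

/-- The polynomial ring in two blocks of `a` and `b` variables `xᵢ = X (inl i)`, `yⱼ = X (inr j)`. -/
local notation3 "SP[" a ", " b "]" => MvPolynomial (Fin a ⊕ Fin b) k

/-- The Segre ring `k[xᵢyⱼ] ⊆ k[x, y]`: coordinate ring of the affine cone over the Segre embedding of
`ℙᵃ⁻¹ × ℙᵇ⁻¹`. -/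
local notation3 "SR[" a ", " b "]" =>
  Algebra.adjoin k (Set.range (fun ij : Fin a × Fin b =>
    (MvPolynomial.X (Sum.inl ij.1) * MvPolynomial.X (Sum.inr ij.2) : MvPolynomial (Fin a ⊕ Fin b) k)))

/-- **`a + b − 1` algebraically independent Segre monomials.** The `k`-algebra map `k[T_v : v ≠ inl i₀] → SR[a,b]`,
`T_{inl i} ↦ xᵢy_{j₀}` (`i ≠ i₀`), `T_{inr j} ↦ x_{i₀}yⱼ`, is injective: as a map to `k[x,y] = k[ℕ^{a+b}]` it is the monomial map
along the additive exponent map `θ` with `θ(ε_{inl i}) = ε_{inl i} + ε_{inr j₀}`, `θ(ε_{inr j}) = ε_{inl i₀} + ε_{inr j}`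
(`MvPolynomial.algHom_ext`), and `θ` is injective because it has the additive retraction `π` (`ε_{inl i} ↦ ε_{inl i} − ε_{inr j₀}`
for `i ≠ i₀`, `ε_{inl i₀} ↦ 0`, `ε_{inr j} ↦ ε_{inr j}`) over `ℤ` (`AddMonoidAlgebra.mapDomain_injective`). [folklore] -/
theorem segre_exists_injective_algHom_mvPolynomial (a b : ℕ) (i₀ : Fin a) (j₀ : Fin b) :
    ∃ φ : MvPolynomial {v : Fin a ⊕ Fin b // v ≠ Sum.inl i₀} k →ₐ[k] ↥SR[a, b], Function.Injective φ := by
  classical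
  -- exponents of the images of the variables
  let u : {v : Fin a ⊕ Fin b // v ≠ Sum.inl i₀} → (Fin a ⊕ Fin b →₀ ℕ) := fun v =>
    Sum.elim (fun i => Finsupp.single (Sum.inl i) 1 + Finsupp.single (Sum.inr j₀) 1)
      (fun j => Finsupp.single (Sum.inl i₀) 1 + Finsupp.single (Sum.inr j) 1) v.1
  -- each image monomial is a Segre generator
  have hu : ∀ v, ∃ ij : Fin a × Fin b, (monomial (u v) (1 : k) : SP[a, b]) = X (Sum.inl ij.1) * X (Sum.inr ij.2) := by
    rintro ⟨v, hv⟩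
    rcases v with i | j
    · exact ⟨(i, j₀), (segreMemIff_X_mul_X_eq_monomial k a b i j₀).symm⟩
    · exact ⟨(i₀, j), (segreMemIff_X_mul_X_eq_monomial k a b i₀ j).symm⟩
  let φ₀ : MvPolynomial {v : Fin a ⊕ Fin b // v ≠ Sum.inl i₀} k →ₐ[k] SP[a, b] :=
    aeval fun v => (monomial (u v) (1 : k) : SP[a, b])
  have hφ₀mem : ∀ q, φ₀ q ∈ SR[a, b] := by
    intro q
    have hr : φ₀ q ∈ (aeval (R := k) fun v => (monomial (u v) (1 : k) : SP[a, b])).range := ⟨q, rfl⟩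
    rw [← Algebra.adjoin_range_eq_range_aeval] at hr
    refine Algebra.adjoin_mono ?_ hr
    rintro _ ⟨v, rfl⟩
    obtain ⟨ij, hij⟩ := hu v
    exact ⟨ij, hij.symm⟩
  refine ⟨φ₀.codRestrict (SR[a, b]) hφ₀mem, ?_⟩
  -- injectivity of `φ₀`: it is the monomial map along an injective exponent map
  suffices hinj : Function.Injective φ₀ by
    intro q q' h
    exact hinj (congrArg Subtype.val h)
  let θ : ({v : Fin a ⊕ Fin b // v ≠ Sum.inl i₀} →₀ ℕ) →+ (Fin a ⊕ Fin b →₀ ℕ) :=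
    Finsupp.liftAddHom fun v => multiplesHom _ (u v)
  have hθ1 : ∀ v, θ (Finsupp.single v 1) = u v := by
    intro v
    rw [Finsupp.liftAddHom_apply_single, multiplesHom_apply, one_smul]
  -- the retraction `π` (over `ℤ`): `π ∘ θ` is the cast `ℕ^τ → ℤ^τ`
  let c : Fin a ⊕ Fin b → ({v : Fin a ⊕ Fin b // v ≠ Sum.inl i₀} →₀ ℤ) :=
    Sum.elim (fun i => if h : i = i₀ then 0 else
        Finsupp.single ⟨Sum.inl i, fun e => h (Sum.inl_injective e)⟩ 1 - Finsupp.single ⟨Sum.inr j₀, Sum.inr_ne_inl⟩ 1)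
      (fun j => Finsupp.single ⟨Sum.inr j, Sum.inr_ne_inl⟩ 1)
  let π : (Fin a ⊕ Fin b →₀ ℕ) →+ ({v : Fin a ⊕ Fin b // v ≠ Sum.inl i₀} →₀ ℤ) :=
    Finsupp.liftAddHom fun w => multiplesHom _ (c w)
  have hπ1 : ∀ w, π (Finsupp.single w 1) = c w := by
    intro w
    rw [Finsupp.liftAddHom_apply_single, multiplesHom_apply, one_smul]
  have hπu : ∀ v, π (u v) = Finsupp.single v 1 := by
    rintro ⟨v, hv⟩
    rcases v with i | j
    · have hi : i ≠ i₀ := fun e => hv (by rw [e])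
      simp [u, c, hπ1, hi]
    · simp [u, c, hπ1]
  have hπθ : π.comp θ = Finsupp.mapRange.addMonoidHom (Nat.castAddMonoidHom ℤ) := by
    refine Finsupp.addHom_ext fun v n => ?_
    rw [AddMonoidHom.comp_apply, Finsupp.mapRange.addMonoidHom_apply, Finsupp.mapRange_single,
      show Finsupp.single v n = n • Finsupp.single v 1 by rw [Finsupp.smul_single, smul_eq_mul, mul_one],
      map_nsmul, map_nsmul, hθ1, hπu, Finsupp.smul_single]
    simp
  have hθ : Function.Injective θ := by
    intro e e' h
    have h' := congrArg π h
    rw [← AddMonoidHom.comp_apply, ← AddMonoidHom.comp_apply, hπθ] at h'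
    exact Finsupp.mapRange_injective _ (by simp) Nat.cast_injective h'
  -- `φ₀` is the monomial map along `θ`
  have hφ₀ : (φ₀ : MvPolynomial {v : Fin a ⊕ Fin b // v ≠ Sum.inl i₀} k →+* SP[a, b]) =
      AddMonoidAlgebra.mapDomainRingHom k θ := by
    refine MvPolynomial.ringHom_ext (fun r => ?_) (fun v => ?_)
    · rw [AlgHom.coe_toRingHom, MvPolynomial.algHom_C, MvPolynomial.algebraMap_eq, AddMonoidAlgebra.mapDomainRingHom_apply,
        C_apply, C_apply,
        ← single_eq_monomial, ← single_eq_monomial, AddMonoidAlgebra.mapDomain_single, map_zero]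
    · rw [AlgHom.coe_toRingHom, AddMonoidAlgebra.mapDomainRingHom_apply, MvPolynomial.X, ← single_eq_monomial,
        AddMonoidAlgebra.mapDomain_single, hθ1]
      simp only [φ₀, single_eq_monomial, aeval_monomial, map_one, one_mul, Finsupp.prod_single_index, pow_zero, pow_one]
  intro q q' h
  have h2 : AddMonoidAlgebra.mapDomainRingHom k θ q = AddMonoidAlgebra.mapDomainRingHom k θ q' := by
    rw [← hφ₀]
    exact h
  exact AddMonoidAlgebra.mapDomain_injective hθ h2

/-- **`dim k[xᵢyⱼ] ≥ a + b − 1`** (for `a, b ≥ 1`, witnessed by `i₀ : Fin a`, `j₀ : Fin b`). The Segre ring is an affine domain, so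
its Krull dimension is its transcendence degree (`exists_ringKrullDim_eq_and_trdeg_eq`, Matsumura Thm. 5.6), which is at least
that of `k[T_v : v ≠ inl i₀]`, i.e. `a + b − 1`, by the injective monomial map `segre_exists_injective_algHom_mvPolynomial`
(`trdeg_le_of_injective`, `MvPolynomial.trdeg_of_isDomain`). [folklore; cite: Matsumura1987, Thm. 5.6] -/
theorem segre_le_ringKrullDim (a b : ℕ) (i₀ : Fin a) (j₀ : Fin b) :
    ((a + b - 1 : ℕ) : WithBot ℕ∞) ≤ ringKrullDim ↥SR[a, b] := by
  classical
  obtain ⟨φ, hφ⟩ := segre_exists_injective_algHom_mvPolynomial k a b i₀ j₀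
  haveI : Algebra.FiniteType k ↥SR[a, b] := Algebra.FiniteType.adjoin_of_finite (Set.finite_range _)
  haveI : FaithfulSMul k (MvPolynomial {v : Fin a ⊕ Fin b // v ≠ Sum.inl i₀} k) :=
    (faithfulSMul_iff_algebraMap_injective k _).mpr (C_injective _ _)
  obtain ⟨n, hn, htr⟩ := exists_ringKrullDim_eq_and_trdeg_eq k ↥SR[a, b]
  have h1 : Algebra.trdeg k (MvPolynomial {v : Fin a ⊕ Fin b // v ≠ Sum.inl i₀} k) ≤ Algebra.trdeg k ↥SR[a, b] :=
    trdeg_le_of_injective φ hφ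
  rw [htr, MvPolynomial.trdeg_of_isDomain, Cardinal.mk_fintype, Cardinal.lift_natCast] at h1
  have h2 : Fintype.card {v : Fin a ⊕ Fin b // v ≠ Sum.inl i₀} = a + b - 1 := by
    simp only [ne_eq, Fintype.card_subtype_compl, Fintype.card_sum, Fintype.card_fin, Fintype.card_unique]
  rw [h2] at h1
  have h3 : a + b - 1 ≤ n := by exact_mod_cast h1
  rw [hn]
  exact_mod_cast h3

end Cones

end Summit.ResolutionOfSingularities.ResolutionOfSingularities.Theorems.FRationalResolution

end
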